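import Literature.NumberTheory.GaloisRepresentations.GaloisCohomology
import Literature.NumberTheory.GaloisRepresentations.ContinuousH1
import Literature.NumberTheory.GaloisRepresentations.AbsGaloisGroupOpenNormal
import Mathlib.Algebra.Homology.ShortComplex.ModuleCat

/-!
# Galois cohomology of discrete modules: proofs of named facts (Hilbert 90; inflation)

This file discharges named facts of
`Literature/NumberTheory/GaloisRepresentations/GaloisCohomology.lean` (which stays the home of
the definitions and of the `def X : Prop` statements; consumers holding `(h : X K)` /
`(h : X K M)` are fed the `X_holds` theorems proved here):

* `Literature.subsingleton_galoisCohomology_units_one K`: the first continuous cohomology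
  `H¹(K, K̄ˣ) = continuousCohomology 1 (DiscreteGaloisModule.units K).toTopRep` of the
  discrete `Γ_K`-module `K̄ˣ` has a single element, for **every** field `K` (§ Hilbert 90);
* `Literature.galoisCohomology.exists_inf_eq_one K M`: every class of `H¹(K, M)`, `M` a discrete
  `Γ_K`-module, is inflated from `H¹(Γ_K ⧸ Γ_E, M^{Γ_E})` for some finite Galois `E/K`
  (§ Inflation from finite Galois quotients).

## Main statements

* `Literature.NumberTheory.GaloisRepresentations.ContinuousCohomology.subsingleton_one_of_homogeneous`,
  `Literature.NumberTheory.GaloisRepresentations.ContinuousCohomology.subsingleton_one_of_inhomogeneous`: vanishing criteria for Mathlib's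
  `continuousCohomology 1 X` (`X : TopRep k G`, any topological group `G`): it suffices that every
  homogeneous continuous `1`-cocycle is a coboundary, resp. that every continuous inhomogeneous
  cocycle `φ : G → X`, `φ(gh) = φ(g) + g·φ(h)`, is of the form `g ↦ g·m - m`.  (Exactness of the
  complex of homogeneous cochains in `TopModuleCat k` is tested after the faithful,
  homology-preserving forgetful functor to `ModuleCat k`.)
* `Literature.NumberTheory.GaloisRepresentations.AlgEquiv.exists_smul_div_eq_of_isOpen`: Hilbert 90 with locally constant cocycles for an
  arbitrary normal extension `L/K`: a multiplicative `1`-cocycle `f : Aut_K(L) → Lˣ` (Mathlib's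
  `IsMulCocycle₁` shape `f(gh) = g(f h) · f(g)`) which is `1` on a Krull-open set is `g ↦ g(x)/x`.
  Serre's proof: factor through a finite normal level (`krullTopology_mem_nhds_one_iff_of_normal`,
  `AlgEquiv.restrictNormalHom`), Poincaré series, Dedekind independence
  (`linearIndependent_monoidHom`).  Mathlib has the finite case
  (`groupCohomology.isMulCoboundary₁_of_isMulCocycle₁_of_aut_to_units`, not imported).
* `Literature.subsingleton_galoisCohomology_units_one_holds : subsingleton_galoisCohomology_units_one K`.
* `Literature.NumberTheory.GaloisRepresentations.exists_finiteDimensional_isGalois_of_mem_nhds_one`: every neighbourhood of `1` in `Γ_K`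
  contains `Gal(K̄/E)` for some finite **Galois** `E ⊆ K̄`, in every characteristic (from
  `krullTopology_mem_nhds_one_iff_of_normal` and `Literature.NumberTheory.GaloisRepresentations.exists_isGalois_fixingSubgroup_eq` of
  `AbsGaloisGroupOpenNormal.lean`).
* `Literature.galoisCohomology.exists_inf_eq_one_holds : galoisCohomology.exists_inf_eq_one K M`:
  Serre, *Galois Cohomology* (1997), Ch. I §2.2, Prop. 8 with Cor. 1
  (`H^q(G, A) = lim→ H^q(G/U, A^U)`, `U` over the open normal subgroups; proof there: the
  canonical map `lim→ C•(G/U, A^U) → C•(G, A)` is an isomorphism of complexes, i.e. continuous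
  cochains with values in a discrete module are locally constant and come from a finite
  quotient), in degree `1` and for one class; Neukirch–Schmidt–Wingberg (1.2.5).  Proof here
  (Serre's argument for a single `1`-cocycle, no compactness needed): represent the class by a
  continuous crossed homomorphism `φ : Γ_K → M` (`Literature.NumberTheory.GaloisRepresentations.oneCocycleClass_surjective` of
  `ContinuousH1.lean`); `φ⁻¹ 0` is a neighbourhood of `1` (`M` discrete, `φ 1 = 0`), hence
  contains `N = Gal(K̄/E)` with `E/K` finite Galois; the cocycle identity
  `φ (σ τ) = φ σ + σ • φ τ` gives `φ (σ n) = φ σ = φ (n σ)` and `n • φ σ = φ σ` for `n ∈ N`, so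
  `φ` descends to a crossed homomorphism `ψ` of the discrete group `Γ_K ⧸ N` with values in
  `M^N`, and `inf [ψ] = [ψ ∘ (Γ_K → Γ_K ⧸ N)] = [φ]` (`Literature.NumberTheory.GaloisRepresentations.map_oneCocycleClass`).

## References

* J.-P. Serre, *Local Fields* (1979), GTM 67: Ch. VII §3 (cohomology via cochains), Ch. X §1,
  Prop. 2 (`H¹(G, K*) = 0`), Ch. X §3 (infinite Galois extensions, continuous cochains).
* J.-P. Serre, *Galois Cohomology* (1997), Ch. I §2.2, Prop. 8, Cor. 1. [Serre1997]
* J. Neukirch, A. Schmidt, K. Wingberg, *Cohomology of Number Fields*, 2nd ed. (2008), (1.2.5).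
  [NeukirchSchmidtWingberg2008]
-/

noncomputable section

open CategoryTheory Field Topology
open scoped ContRepresentation

namespace Literature.NumberTheory.GaloisRepresentations

universe u

/-! ### Hilbert's Theorem 90: proof of `subsingleton_galoisCohomology_units_one` -/

section HilbertNinety

/-- An object of `TopModuleCat k` which is a zero object of the category has exactly one
element (apply `𝟙 M = 0` to an element).  Placed in the `Literature.TopModuleCat` namespace, named after
the Mathlib category. [folklore] -/
theorem TopModuleCat.subsingleton_of_isZero {k : Type*} [Ring k] [TopologicalSpace k]
    {M : TopModuleCat k} (h : Limits.IsZero M) : Subsingleton M := by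
  refine ⟨fun x y => ?_⟩
  have h1 : (𝟙 M : M ⟶ M) = 0 := h.eq_of_src _ _
  have hx : x = 0 := by simpa using congrArg (fun f : M ⟶ M => f.hom x) h1
  have hy : y = 0 := by simpa using congrArg (fun f : M ⟶ M => f.hom y) h1
  rw [hx, hy]

namespace ContinuousCohomology

open TopRep ContRepresentation

variable {k G : Type*} [Ring k] [Group G] [TopologicalSpace k] [TopologicalSpace G]
  [IsTopologicalGroup G]

set_option allowUnsafeReducibility true in
attribute [local reducible] CategoryTheory.Functor.mapHomologicalComplex

/-- Vanishing criterion for the first continuous cohomology of a topological representation `X`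
in terms of Mathlib's homogeneous cochains: if every homogeneous continuous `1`-cocycle
`σ ∈ C(G, C(G, X))^G` is the differential of a homogeneous `0`-cochain, then `H¹(G, X)` has a
single element.  Proof: the forgetful functor `TopModuleCat k ⥤ ModuleCat k` is faithful and
preserves homology (it is a left and a right adjoint), so exactness of the complex of homogeneous
cochains in degree `1` can be tested on underlying modules (`ShortComplex.moduleCat_exact_iff`).
Ref: Serre, *Local Fields* (1979), Ch. VII §3 (cochain description of cohomology). [folklore] -/
theorem subsingleton_one_of_homogeneous (X : TopRep k G)
    (H : ∀ σ : (homogeneousCochains X).X 1, ((homogeneousCochains X).d 1 2).hom σ = 0 →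
      ∃ τ : (homogeneousCochains X).X 0, ((homogeneousCochains X).d 0 1).hom τ = σ) :
    Subsingleton (continuousCohomology 1 X) := by
  apply TopModuleCat.subsingleton_of_isZero
  rw [← HomologicalComplex.exactAt_iff_isZero_homology,
    HomologicalComplex.exactAt_iff' _ 0 1 2 (by simp) (by simp),
    ← ShortComplex.exact_map_iff_of_faithful _ (forget₂ (TopModuleCat k) (ModuleCat k)),
    ShortComplex.moduleCat_exact_iff]
  intro x₂ hx₂
  obtain ⟨τ, hτ⟩ := H x₂ hx₂
  exact ⟨τ, hτ⟩

/-- The differential `C(G, C(G, X))^G → C(G, C(G, C(G, X)))^G` of Mathlib's complex of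
homogeneous cochains, evaluated: `(dσ)(x)(y)(z) = σ(y)(z) - (σ(x)(z) - σ(x)(y))`
(unfolding `TopRep.d_succ`, `TopRep.d_zero`). [folklore] -/
lemma homogeneousCochains_d_one_apply (X : TopRep k G) (σ : (homogeneousCochains X).X 1)
    (x y z : G) :
    (((((homogeneousCochains X).d 1 2).hom σ).1 x : C(G, C(G, X))) y : C(G, X)) z =
      (σ.1 y : C(G, X)) z - ((σ.1 x : C(G, X)) z - (σ.1 x : C(G, X)) y) := by
  rw [homogeneousCochains.d_apply]
  simp [d_succ, d_zero, TopRep.hom_sub, ContIntertwiningMap.sub_apply]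

/-- The differential `C(G, X)^G → C(G, C(G, X))^G` of Mathlib's complex of homogeneous cochains,
evaluated: `(dτ)(x)(y) = τ(y) - τ(x)`. [folklore] -/
lemma homogeneousCochains_d_zero_apply (X : TopRep k G) (τ : (homogeneousCochains X).X 0)
    (x y : G) :
    ((((homogeneousCochains X).d 0 1).hom τ).1 x : C(G, X)) y =
      (τ.1 : C(G, X)) y - (τ.1 : C(G, X)) x := by
  rw [homogeneousCochains.d_apply]
  simp [d_succ, d_zero, TopRep.hom_sub, ContIntertwiningMap.sub_apply]

/-- `G`-invariance of a homogeneous `1`-cochain `σ ∈ C(G, C(G, X))^G`, evaluated: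
`ρ(g)(σ(g⁻¹x)(g⁻¹y)) = σ(x)(y)` (Mathlib `ContRepresentation.coind₁_apply_apply`). [folklore] -/
lemma homogeneousCochains_one_invariance (X : TopRep k G) (σ : (homogeneousCochains X).X 1)
    (g x y : G) :
    X.ρ g ((σ.1 (g⁻¹ * x) : C(G, X)) (g⁻¹ * y)) = (σ.1 x : C(G, X)) y := by
  simpa using congr($(σ.2 g) x y)

/-- Vanishing criterion for `H¹` in terms of **inhomogeneous continuous cocycles**: if every
continuous map `φ : G → X` with `φ(gh) = φ(g) + g·φ(h)` is of the form `g ↦ g·m - m`, then the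
first continuous cohomology `H¹(G, X)` (Mathlib `continuousCohomology 1 X`) has a single element.
The passage homogeneous ↔ inhomogeneous is the usual one: `φ(g) = σ(1)(g)`, and conversely
`σ(x)(y) = φ(y) - φ(x)`, `τ(x) = ρ(x) m = φ(x) + m`.
Ref: Serre, *Local Fields* (1979), Ch. VII §3 (homogeneous "covariant" cochains vs inhomogeneous
cochains). [folklore] -/
theorem subsingleton_one_of_inhomogeneous (X : TopRep k G)
    (H : ∀ φ : C(G, X), (∀ g h, φ (g * h) = φ g + X.ρ g (φ h)) →
      ∃ m : X, ∀ g, φ g = X.ρ g m - m) :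
    Subsingleton (continuousCohomology 1 X) := by
  refine subsingleton_one_of_homogeneous X fun σ hσ => ?_
  have hcoc : ∀ x y z : G,
      (σ.1 y : C(G, X)) z - ((σ.1 x : C(G, X)) z - (σ.1 x : C(G, X)) y) = 0 := by
    intro x y z
    have := congr(((($hσ).1 x : C(G, C(G, X))) y : C(G, X)) z)
    rw [homogeneousCochains_d_one_apply] at this
    simpa using this
  set φ : C(G, X) := σ.1 1 with hφdef
  have hφ : ∀ g h, φ (g * h) = φ g + X.ρ g (φ h) := by
    intro g h
    have h1 := homogeneousCochains_one_invariance X σ g g (g * h)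
    rw [inv_mul_cancel, inv_mul_cancel_left] at h1
    have h2 := hcoc 1 g (g * h)
    rw [← h1, sub_eq_zero] at h2
    change (σ.1 1 : C(G, X)) (g * h) = (σ.1 1 : C(G, X)) g + X.ρ g ((σ.1 1 : C(G, X)) h)
    rw [h2, add_sub_cancel]
  obtain ⟨m, hm⟩ := H φ hφ
  have hτ : ∀ x, (φ + ContinuousMap.const G m) x = X.ρ x m := fun x => by simp [hm x]
  refine ⟨⟨φ + ContinuousMap.const G m, ?_⟩, Subtype.ext ?_⟩
  · rw [mem_invariants]
    intro g
    ext x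
    rw [coind₁_apply_apply, hτ, hτ, ← ContinuousLinearMap.comp_apply,
      ← ContinuousLinearMap.mul_def, ← map_mul, mul_inv_cancel_left]
  · ext x y
    rw [homogeneousCochains_d_zero_apply]
    change (φ + ContinuousMap.const G m) y - (φ + ContinuousMap.const G m) x = _
    have h3 := hcoc 1 x y
    rw [sub_eq_zero] at h3
    rw [hτ, hτ, h3]
    change _ = φ y - φ x
    rw [hm, hm]
    abel

end ContinuousCohomology

/-- **Hilbert's Theorem 90 with locally constant cocycles, for an arbitrary normal extension
`L/K`** (finite or infinite, separable or not): if `f : Aut_K(L) → Lˣ` satisfies the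
multiplicative `1`-cocycle identity `f(gh) = g(f(h)) · f(g)` (literally Mathlib's
`groupCohomology.IsMulCocycle₁ f`, not imported here) and is `1` on a Krull-open set, then
`f(g) = g(x)/x` for some `x ∈ Lˣ` (i.e. `groupCohomology.IsMulCoboundary₁ f`).  This is Serre's
proof verbatim: `{f = 1}` contains `Gal(L/E)` for a finite normal subextension `E/K`
(`krullTopology_mem_nhds_one_iff_of_normal`), so `f` factors through the finite group
`Aut_K(E)` (`AlgEquiv.restrictNormalHom E`, kernel `Gal(L/E)` by
`IntermediateField.restrictNormalHom_ker`); by Dedekind's independence of characters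
(`linearIndependent_monoidHom`) some Poincaré series `b = ∑ₑ f(ẽ) · e(z)`, `z ∈ E`, is non-zero,
and `g(b) = f(g)⁻¹ b`, whence `f(g) = g(x)/x` with `x = b⁻¹`.  Mathlib has the case `L/K` finite
as `groupCohomology.isMulCoboundary₁_of_isMulCocycle₁_of_aut_to_units`.
Ref: Serre, *Local Fields* (1979), Ch. X §1, Prop. 2 and Ch. X §3 (infinite Galois extensions,
cohomology via continuous cochains). [cite: Serre1979, Ch. X §1, Prop. 2] -/
theorem AlgEquiv.exists_smul_div_eq_of_isOpen {K L : Type*} [Field K] [Field L] [Algebra K L]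
    [Normal K L] (f : (L ≃ₐ[K] L) → Lˣ) (hf : ∀ g h, f (g * h) = g • f h * f g)
    (hopen : IsOpen {g | f g = 1}) : ∃ x : Lˣ, ∀ g, g • x / x = f g := by
  classical
  have h1 : f 1 = 1 := by simpa only [mul_one, one_smul, left_eq_mul] using hf 1 1
  obtain ⟨E, hEfin, hEnorm, hE⟩ :=
    (krullTopology_mem_nhds_one_iff_of_normal K L _).1 (hopen.mem_nhds h1)
  set res := AlgEquiv.restrictNormalHom (F := K) (K₁ := L) E with hres
  -- `f` is constant on the fibres of `res`
  have hker : ∀ a b : L ≃ₐ[K] L, res a = res b → f a = f b := by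
    intro a b hab
    have hmem : a⁻¹ * b ∈ E.fixingSubgroup := by
      rw [← IntermediateField.restrictNormalHom_ker, MonoidHom.mem_ker, map_mul, map_inv, hab,
        inv_mul_cancel]
    have h2 : f (a⁻¹ * b) = 1 := hE hmem
    have h3 := hf a (a⁻¹ * b)
    rw [mul_inv_cancel_left, h2, smul_one, one_mul] at h3
    exact h3.symm
  have hsurj : Function.Surjective res := AlgEquiv.restrictNormalHom_surjective L
  set lift : (E ≃ₐ[K] E) → (L ≃ₐ[K] L) := fun e => (hsurj e).choose with hlift_def
  have hlift : ∀ e, res (lift e) = e := fun e => (hsurj e).choose_spec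
  -- the descended cocycle `fbar` (values still in `Lˣ`)
  set fbar : (E ≃ₐ[K] E) → Lˣ := fun e => f (lift e) with hfbar_def
  have hequiv : ∀ g e, fbar (res g * e) = g • fbar e * f g := by
    intro g e
    have : res (lift (res g * e)) = res (g * lift e) := by rw [hlift, map_mul, hlift]
    change f (lift (res g * e)) = g • f (lift e) * f g
    rw [hker _ _ this, hf]
  have hcomm : ∀ (g : L ≃ₐ[K] L) (e : E ≃ₐ[K] E) (z : E),
      g (algebraMap E L (e z)) = algebraMap E L ((res g * e) z) := by
    intro g e z
    rw [AlgEquiv.mul_apply]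
    exact (AlgEquiv.restrictNormal_commutes g E (e z)).symm
  -- Dedekind's independence of the characters `z ↦ e(z)` of `E` with values in `L`
  let F : (E ≃ₐ[K] E) → (E →* L) := fun e =>
    (algebraMap E L : E →+* L).toMonoidHom.comp (e : E →+* E).toMonoidHom
  have hFapply : ∀ e z, F e z = algebraMap E L (e z) := fun e z => rfl
  have hF : Function.Injective F := by
    intro e₁ e₂ h
    ext z
    have := DFunLike.congr_fun h z
    rw [hFapply, hFapply] at this
    exact congrArg Subtype.val ((algebraMap E L).injective this)
  obtain ⟨z, hz⟩ : ∃ z : E, ∑ e, (fbar e : L) * algebraMap E L (e z) ≠ 0 := by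
    by_contra! hzero
    have hli : LinearIndependent L (M := E → L) (fun e : E ≃ₐ[K] E => (F e : E → L)) :=
      (linearIndependent_monoidHom E L).comp F hF
    rw [Fintype.linearIndependent_iff] at hli
    have := hli (fun e => (fbar e : L)) ?_ 1
    · exact (fbar 1).ne_zero this
    · funext w
      simp only [Finset.sum_apply, Pi.smul_apply, smul_eq_mul, Pi.zero_apply, hFapply]
      exact hzero w
  -- the Poincaré series `b` and the identity `f(g) · g(b) = b`
  set b : L := ∑ e, (fbar e : L) * algebraMap E L (e z) with hb
  have hgb : ∀ g : L ≃ₐ[K] L, (f g : L) * g b = b := by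
    intro g
    simp only [hb, map_sum, map_mul, Finset.mul_sum]
    refine Fintype.sum_bijective (fun e => res g * e) (Group.mulLeft_bijective (res g)) _ _
      (fun e => ?_)
    have h4 := congrArg (fun u : Lˣ => (u : L)) (hequiv g e)
    simp only [Units.val_mul, AlgEquiv.smul_units_def, Units.coe_map, MonoidHom.coe_coe] at h4
    rw [h4, ← hcomm]
    ring
  have hgbne : ∀ g : L ≃ₐ[K] L, g b ≠ 0 := fun g => (map_ne_zero g).2 hz
  refine ⟨(Units.mk0 b hz)⁻¹, fun g => Units.ext ?_⟩
  rw [Units.val_div_eq_div_val, AlgEquiv.smul_units_def, Units.coe_map, MonoidHom.coe_coe,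
    Units.val_inv_eq_inv_val, Units.val_mk0, map_inv₀, inv_div_inv, eq_comm, eq_div_iff (hgbne g)]
  exact hgb g

variable (K : Type u) [Field K]

/-- **Hilbert's Theorem 90**, `H¹(K, K̄ˣ) = 0`: proof of the named fact
`subsingleton_galoisCohomology_units_one`.  A class in Mathlib's `continuousCohomology 1` of the
discrete module `K̄ˣ` is represented by a continuous inhomogeneous cocycle
`Γ_K → K̄ˣ` (`ContinuousCohomology.subsingleton_one_of_inhomogeneous`), which is locally
constant, hence a coboundary by `AlgEquiv.exists_smul_div_eq_of_isOpen` applied to the normal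
extension `K̄/K`.
Ref: Serre, *Local Fields* (1979), Ch. X §1, Prop. 2 (finite case, Poincaré series); Ch. X §3
(infinite Galois extensions, continuous cochains). [cite: Serre1979, Ch. X §1, Prop. 2] -/
theorem subsingleton_galoisCohomology_units_one_holds :
    subsingleton_galoisCohomology_units_one K := by
  classical
  unfold subsingleton_galoisCohomology_units_one galoisCohomology
  refine ContinuousCohomology.subsingleton_one_of_inhomogeneous _ fun φ hφ => ?_
  -- the multiplicative cocycle `u : Γ_K → K̄ˣ` underlying `φ`
  let u : absoluteGaloisGroup K → (AlgebraicClosure K)ˣ := fun σ =>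
    (DiscreteGaloisModule.UnitsCarrier.toAdditive (φ σ)).toMul
  have hu : ∀ σ τ, u (σ * τ) = u σ * σ • u τ := by
    intro σ τ
    change (DiscreteGaloisModule.UnitsCarrier.toAdditive (φ (σ * τ))).toMul =
      (DiscreteGaloisModule.UnitsCarrier.toAdditive (φ σ)).toMul *
        σ • (DiscreteGaloisModule.UnitsCarrier.toAdditive (φ τ)).toMul
    rw [hφ, map_add, toMul_add]
    rfl
  -- transport to `K̄ ≃ₐ[K] K̄` with Mathlib's action `g • x = Units.map g x` on `K̄ˣ`
  let f : (AlgebraicClosure K ≃ₐ[K] AlgebraicClosure K) → (AlgebraicClosure K)ˣ := fun g =>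
    u ((absoluteGaloisGroup.toAlgEquiv K).symm g)
  have hsmul : ∀ (g : AlgebraicClosure K ≃ₐ[K] AlgebraicClosure K) (x : (AlgebraicClosure K)ˣ),
      g • x = ((absoluteGaloisGroup.toAlgEquiv K).symm g) • x := fun g x => Units.ext rfl
  have hf : ∀ g h, f (g * h) = g • f h * f g := by
    intro g h
    change u ((absoluteGaloisGroup.toAlgEquiv K).symm g * (absoluteGaloisGroup.toAlgEquiv K).symm h)
      = _
    rw [hu, hsmul, mul_comm]
  have hopen : IsOpen {g | f g = 1} := by
    have hc : IsOpen ((fun σ : absoluteGaloisGroup K => φ σ) ⁻¹' {0}) :=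
      (isOpen_discrete _).preimage φ.continuous
    exact hc
  obtain ⟨x, hx⟩ := AlgEquiv.exists_smul_div_eq_of_isOpen f hf hopen
  refine ⟨DiscreteGaloisModule.UnitsCarrier.ofUnits x, fun σ => ?_⟩
  apply DiscreteGaloisModule.UnitsCarrier.toAdditive.injective
  apply Additive.toMul.injective
  change u σ = (DiscreteGaloisModule.UnitsCarrier.toAdditive
    ((DiscreteGaloisModule.units K) σ (DiscreteGaloisModule.UnitsCarrier.ofUnits x) -
      DiscreteGaloisModule.UnitsCarrier.ofUnits x)).toMul
  rw [map_sub, toMul_sub]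
  change u σ = σ • x / x
  have h5 := hx (absoluteGaloisGroup.toAlgEquiv K σ)
  rw [hsmul] at h5
  exact h5.symm

end HilbertNinety

/-! ### Inflation from finite Galois quotients: proof of `galoisCohomology.exists_inf_eq_one` -/

section InflationUnion

variable (K : Type u) [Field K]

/-- Every neighbourhood `U` of `1` in `Γ_K = Gal(K̄/K)` (Krull topology) contains
`Gal(K̄/E) = {σ | σ|_E = id}` for some *finite Galois* subextension `E/K` of `K̄/K`, in every
characteristic: `U ⊇ Gal(K̄/E₀)` with `E₀/K` finite normal
(`krullTopology_mem_nhds_one_iff_of_normal`), and the open normal subgroup `Gal(K̄/E₀)` is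
`Gal(K̄/E)` for a finite Galois `E` (`Literature.NumberTheory.GaloisRepresentations.exists_isGalois_fixingSubgroup_eq`; `E` is the
separable closure of `K` in `E₀`).  In other words the open normal subgroups `Gal(K̄/E)`, `E/K`
finite Galois, form a neighbourhood basis of `1` in `Γ_K`.
Ref: Serre, *Galois Cohomology* (1997), Ch. I §1.1; Neukirch, *Algebraic Number Theory*,
Ch. IV §1. [folklore] -/
theorem exists_finiteDimensional_isGalois_of_mem_nhds_one {U : Set (absoluteGaloisGroup K)}
    (hU : U ∈ 𝓝 (1 : absoluteGaloisGroup K)) :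
    ∃ E : IntermediateField K (AlgebraicClosure K), FiniteDimensional K E ∧ IsGalois K E ∧
      ∀ σ : absoluteGaloisGroup K, (∀ x ∈ E, σ • x = x) → σ ∈ U := by
  obtain ⟨E₀, hfd, hn, hEU⟩ :=
    (krullTopology_mem_nhds_one_iff_of_normal K (AlgebraicClosure K) U).1 hU
  haveI := hfd
  haveI := hn
  haveI : (E₀.fixingSubgroup).Normal := by
    rw [← IntermediateField.restrictNormalHom_ker]
    infer_instance
  obtain ⟨E, hEfd, hEgal, hE⟩ :=
    exists_isGalois_fixingSubgroup_eq E₀.fixingSubgroup (IntermediateField.fixingSubgroup_isOpen E₀)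
  refine ⟨E, hEfd, hEgal, fun σ hσ => hEU ?_⟩
  rw [SetLike.mem_coe, ← hE, IntermediateField.mem_fixingSubgroup_iff]
  exact hσ

variable (M : Type u) [AddCommGroup M] [TopologicalSpace M] [DiscreteTopology M]

/-- **`H¹(K, M)` is the union of the inflations from its finite Galois quotients**: the named
fact `Literature.NumberTheory.GaloisRepresentations.galoisCohomology.exists_inf_eq_one` holds, i.e. every class in `H¹(K, M)` (`M` a
discrete `Γ_K`-module) is `galoisCohomology.inf ρ (absGaloisFixingSubgroup E) 1 y` for some
finite Galois subextension `E/K` of `K̄/K` and some class `y` of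
`H¹(Γ_K ⧸ Gal(K̄/E), M^{Gal(K̄/E)})`.
This is Serre, *Galois Cohomology* (1997), Ch. I §2.2, Prop. 8 with Cor. 1
(`H^q(G, A) = lim→ H^q(G/U, A^U)` over open normal `U`), in degree `q = 1` and for one class,
equivalently Neukirch–Schmidt–Wingberg (1.2.5).  Proof: represent the class by a continuous
crossed homomorphism `φ` (`Literature.NumberTheory.GaloisRepresentations.oneCocycleClass_surjective`); `φ⁻¹ 0` is a neighbourhood of `1`
(`M` discrete, `φ 1 = 0`), hence contains `N = Gal(K̄/E)` with `E/K` finite Galois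
(`Literature.NumberTheory.GaloisRepresentations.exists_finiteDimensional_isGalois_of_mem_nhds_one`); the cocycle identity makes `φ`
constant on `N`-cosets with values in `M^N`, so `φ` descends to a crossed homomorphism `ψ` of
the discrete group `Γ_K ⧸ N` (`QuotientGroup.discreteTopology`) into `M^N`, and `inf [ψ] = [φ]`
by `Literature.NumberTheory.GaloisRepresentations.map_oneCocycleClass`.
[cite: Serre1997, Ch. I §2.2, Prop. 8, Cor. 1] [cite: NeukirchSchmidtWingberg2008, (1.2.5)] -/
theorem galoisCohomology.exists_inf_eq_one_holds : galoisCohomology.exists_inf_eq_one K M := by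
  intro ρ x
  -- a continuous crossed homomorphism `φ : Γ_K → M` representing the class
  obtain ⟨φ, rfl⟩ := oneCocycleClass_surjective ρ.toTopRep x
  have hφ : ∀ g h, φ.1 (g * h) = φ.1 g + ρ g (φ.1 h) := φ.2
  -- the open normal subgroup `N = Gal(K̄/E) ⊆ φ⁻¹ 0`, `E/K` finite Galois
  have hU : {σ : absoluteGaloisGroup K | φ.1 σ = 0} ∈ 𝓝 (1 : absoluteGaloisGroup K) :=
    ((isOpen_discrete ({0} : Set M)).preimage φ.1.continuous).mem_nhds
      (contOneCocycles.apply_one φ)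
  obtain ⟨E, hEfd, hEgal, hEU⟩ := exists_finiteDimensional_isGalois_of_mem_nhds_one K hU
  haveI := hEfd
  haveI := hEgal
  set N : Subgroup (absoluteGaloisGroup K) := absGaloisFixingSubgroup E
  have hNU : ∀ n ∈ N, φ.1 n = 0 := fun n hn =>
    hEU n ((mem_absGaloisFixingSubgroup_iff E n).1 hn)
  have hNnhds : (N : Set (absoluteGaloisGroup K)) ∈ 𝓝 (1 : absoluteGaloisGroup K) := by
    refine Filter.mem_of_superset
      ((IntermediateField.fixingSubgroup_isOpen E).mem_nhds (Subgroup.one_mem _)) fun σ hσ => ?_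
    exact (mem_absGaloisFixingSubgroup_iff E σ).2
      ((IntermediateField.mem_fixingSubgroup_iff _ _).1 hσ)
  haveI : DiscreteTopology (absoluteGaloisGroup K ⧸ N) :=
    QuotientGroup.discreteTopology (Subgroup.isOpen_of_mem_nhds N hNnhds)
  -- `φ` is constant on `N`-cosets and takes values in `M^N`
  have hr : ∀ a, ∀ n ∈ N, φ.1 (a * n) = φ.1 a := fun a n hn => by
    rw [hφ, hNU n hn, map_zero, add_zero]
  have hl : ∀ a, ∀ n ∈ N, φ.1 (n * a) = φ.1 a := fun a n hn => by
    rw [show n * a = a * (a⁻¹ * n * a) by group]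
    exact hr a _ (Subgroup.Normal.conj_mem' inferInstance n hn a)
  have hv : ∀ a, ∀ n ∈ N, ρ n (φ.1 a) = φ.1 a := fun a n hn => by
    have h := hφ n a
    rwa [hNU n hn, zero_add, hl a n hn, eq_comm] at h
  -- descend `φ` to a crossed homomorphism `ψ` of the discrete group `Γ_K ⧸ N` into `M^N`
  let W := Representation.invariants (ρ.toRepresentation.comp N.subtype)
  have hmem : ∀ a, φ.1 a ∈ W := fun a n => hv a n.1 n.2
  let ψfun : absoluteGaloisGroup K ⧸ N → W := fun q => ⟨φ.1 q.out, hmem _⟩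
  have hψ : ∀ a : absoluteGaloisGroup K, (ψfun (a : absoluteGaloisGroup K ⧸ N) : M) = φ.1 a :=
    fun a => by
      obtain ⟨n, hn⟩ := QuotientGroup.mk_out_eq_mul N a
      simp only [ψfun]
      rw [hn, hr _ _ n.2]
  let ψ : contOneCocycles (ρ.quotientInvariants N).toTopRep :=
    ⟨⟨ψfun, continuous_of_discreteTopology⟩, fun g h => by
      induction g using QuotientGroup.induction_on with | H g => ?_
      induction h using QuotientGroup.induction_on with | H h => ?_
      refine Subtype.ext ?_
      change (ψfun ((g : absoluteGaloisGroup K ⧸ N) * (h : absoluteGaloisGroup K ⧸ N)) : M) =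
        (ψfun g : M) + ((ρ.quotientInvariants N (g : absoluteGaloisGroup K ⧸ N) (ψfun h) : W) : M)
      rw [← QuotientGroup.mk_mul, hψ, hψ, DiscreteGaloisModule.quotientInvariants_apply_coe, hψ]
      exact hφ g h⟩
  refine ⟨E, hEfd, hEgal, oneCocycleClass _ ψ, ?_⟩
  -- `inf [ψ] = [ψ ∘ (Γ_K → Γ_K ⧸ N)] = [φ]`
  change (ContinuousCohomology.map (ContinuousMonoidHom.quotientMk N) _ 1) (oneCocycleClass _ ψ) =
    oneCocycleClass _ φ
  rw [map_oneCocycleClass]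
  congr 1
  refine Subtype.ext (ContinuousMap.ext fun a => ?_)
  rw [contOneCocycles.pullback_apply]
  exact hψ a

end InflationUnion

end Literature.NumberTheory.GaloisRepresentations
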